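import Mathlib.Combinatorics.Enumerative.DoubleCounting
import Literature.Combinatorics.Additive.TripleProductPropertySAT
import Literature.Computability.AlgebraicComplexity.TPPGroupExtension
import Summits.MatrixMultiplication.OmegaCensus.CentreIndexSixTPP
import Summits.MatrixMultiplication.OmegaCensus.DihC3SqFinal
import Summits.MatrixMultiplication.OmegaCensus.DihC3SqDih

/-!
# ω-census, family (b3): the class `𝒞₂` — the fibre lemma and THE LAW `9|S||T||U| ≤ 16|G|`

HONEST FRAMING (pub-omega census; verbatim): lottery ticket; floor = certified bounds/negative ranges.
Census BOOKKEEPING (prereg P-031.3, session B, file B2; pub-omega stpp-1 gen 14, filed by gen 17): the fibre lemma of the class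
`𝒞₂`, exactly `CentreIndexSixTPP.fibre_le_five` with the two-component coordinate, stated for INDEPENDENT cell sets (two
distinct cells have non-trivial word `E2 P P' ≠ 1` — the only use the TPP hypothesis ever had): a coset fibre of `K = ⟨c₁, c₂⟩`
maps injectively onto an independent set of the `81`-vertex model graph of the (sorted) label configuration (`DihC3Sq.adj_iff`,
`CentreIndexSix.dn_cast`, `Coord2.kap1_E_fibre` / `kap2_E_fibre`), which has at most `16` elements by the kernel theorem
`DihC3Sq.indep_card_le_sixteen` (`fibre_le_sixteen_indep`).  Double counting over the nine fibres through each cell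
(`card_fibres_through`) gives `9|V| ≤ 16|G|` for an independent `V ⊆ G × T × U` with `1 ∈ T`, `1 ∈ U`, `#T, #U ≤ 3`
(`nine_mul_card_indep_le_basic`; general box `nine_mul_card_indep_le`: `α(G;|G|,3,3) ≤ (16/9)|G|`), hence THE LAW `nine_mul_volume_le` for TPP triples with `|T|, |U| ≤ 3` (basic form via
`exists_basic_tpp`) and `not_realizesTPP_three_three` (`16|G| < 81N ⇒` no `⟨N,3,3⟩` in any order).  The box form is what the
census conjecture C9 (c) needs for the class `𝒞₂` (`BoxUseful.of_coord2`, separate file).  Nothing here is progress on `ω`.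
-/

open Finset
open Literature.Combinatorics.Additive

namespace Summit.MatrixMultiplication.OmegaCensus.DihC3Sq

open CentreIndexSix IndepSearch

variable {G : Type*} [Group G]

/-- The component labels of `lab2` are the `d = 1` labels of the components. [folklore] -/
theorem lab1_lab2 {α : Type*} (κ₁ κ₂ ε : α → ZMod 3) (y : α) :
    lab1 (lab2 κ₁ κ₂ ε y) 0 = lab κ₁ ε y ∧ lab1 (lab2 κ₁ κ₂ ε y) 1 = lab κ₂ ε y := by
  unfold lab1 lab2 lab
  have h1 := (κ₁ y).val_lt; have h2 := (κ₂ y).val_lt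
  split_ifs <;> constructor <;> omega

namespace Coord2

variable {c₁ c₂ : G} {κ₁ κ₂ ε : G → ZMod 3} (h : Coord2 c₁ c₂ κ₁ κ₂ ε)
include h

/-- The sign of a component label is `ε`. [folklore] -/
theorem eOf_lab (κ : G → ZMod 3) (y : G) : eOf (lab κ ε y) = ε y := by
  unfold eOf lab
  have hv := (κ y).val_lt
  rcases h.sign y with e | e
  · rw [if_pos e, if_pos (by omega), e]
  · have hne : ε y ≠ 1 := by rw [e]; decide
    rw [if_neg hne, if_neg (by omega), e]

/-- **Fibre lemma (independent cell sets).** With `T ⊆ {1, t₁, t₂}`, `U ⊆ {1, u₁, u₂}` (labels sorted), at most `16` cells of an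
independent cell set `J` (distinct cells have word `E2 P P' ≠ 1`) with second/third coordinates in `T`/`U` lie in one fibre
`{P : g⁻¹ · key P ∈ K}`.  (The TPP form: `J ⊆ S × T × U` for a TPP triple `(S, T, U)` is independent.) [folklore] -/
theorem fibre_le_sixteen_indep [DecidableEq G] {T U : Finset G} {t₁ t₂ u₁ u₂ : G}
    (hT : ∀ y ∈ T, y = 1 ∨ y = t₁ ∨ y = t₂) (hU : ∀ w ∈ U, w = 1 ∨ w = u₁ ∨ w = u₂)
    (h12 : lab2 κ₁ κ₂ ε t₁ ≤ lab2 κ₁ κ₂ ε t₂) (h34 : lab2 κ₁ κ₂ ε u₁ ≤ lab2 κ₁ κ₂ ε u₂) (g : G) {J : Finset (G × G × G)}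
    (hJT : ∀ P ∈ J, P.2.1 ∈ T) (hJU : ∀ P ∈ J, P.2.2 ∈ U) (hind : ∀ P ∈ J, ∀ P' ∈ J, P ≠ P' → E2 P P' ≠ 1)
    (hJg : ∀ P ∈ J, InK2 c₁ c₂ (g⁻¹ * key2 P)) : #J ≤ 16 := by
  classical
  -- the configuration
  have hl1 := lab2_lt κ₁ κ₂ ε t₁; have hl2 := lab2_lt κ₁ κ₂ ε t₂; have hl3 := lab2_lt κ₁ κ₂ ε u₁; have hl4 := lab2_lt κ₁ κ₂ ε u₂
  set n : ℕ := lab2 κ₁ κ₂ ε t₁ + 18 * lab2 κ₁ κ₂ ε t₂ + 324 * lab2 κ₁ κ₂ ε u₁ + 5832 * lab2 κ₁ κ₂ ε u₂ with hn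
  have hn' : n < 104976 := by omega
  have hsort : sorted n = true := by
    simp only [sorted, Bool.and_eq_true, decide_eq_true_eq]; omega
  have hT1 : labT n 1 = lab2 κ₁ κ₂ ε t₁ := by simp [labT]; omega
  have hT2 : labT n 2 = lab2 κ₁ κ₂ ε t₂ := by simp [labT]; omega
  have hU1 : labU n 1 = lab2 κ₁ κ₂ ε u₁ := by simp [labU]; omega
  have hU2 : labU n 2 = lab2 κ₁ κ₂ ε u₂ := by simp [labU]; omega
  have hT0 : labT n 0 = lab2 κ₁ κ₂ ε 1 := by rw [h.lab2_one]; simp [labT]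
  have hU0 : labU n 0 = lab2 κ₁ κ₂ ε 1 := by rw [h.lab2_one]; simp [labU]
  -- position indices
  let iT : G → ℕ := fun y => if y = 1 then 0 else if y = t₁ then 1 else 2
  let iU : G → ℕ := fun w => if w = 1 then 0 else if w = u₁ then 1 else 2
  have selT : ∀ y ∈ T, (iT y = 0 ∧ y = 1) ∨ (iT y = 1 ∧ y = t₁) ∨ (iT y = 2 ∧ y = t₂) := by
    intro y hy; simp only [iT]
    split_ifs with h1 h2
    · exact Or.inl ⟨rfl, h1⟩
    · exact Or.inr (Or.inl ⟨rfl, h2⟩)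
    · rcases hT y hy with e | e | e
      · exact absurd e h1
      · exact absurd e h2
      · exact Or.inr (Or.inr ⟨rfl, e⟩)
  have selU : ∀ w ∈ U, (iU w = 0 ∧ w = 1) ∨ (iU w = 1 ∧ w = u₁) ∨ (iU w = 2 ∧ w = u₂) := by
    intro w hw; simp only [iU]
    split_ifs with h1 h2
    · exact Or.inl ⟨rfl, h1⟩
    · exact Or.inr (Or.inl ⟨rfl, h2⟩)
    · rcases hU w hw with e | e | e
      · exact absurd e h1
      · exact absurd e h2
      · exact Or.inr (Or.inr ⟨rfl, e⟩)
  have labT_iT : ∀ y ∈ T, iT y < 3 ∧ labT n (iT y) = lab2 κ₁ κ₂ ε y := by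
    intro y hy
    rcases selT y hy with ⟨e, rfl⟩ | ⟨e, rfl⟩ | ⟨e, rfl⟩ <;> rw [e]
    exacts [⟨by omega, hT0⟩, ⟨by omega, hT1⟩, ⟨by omega, hT2⟩]
  have labU_iU : ∀ w ∈ U, iU w < 3 ∧ labU n (iU w) = lab2 κ₁ κ₂ ε w := by
    intro w hw
    rcases selU w hw with ⟨e, rfl⟩ | ⟨e, rfl⟩ | ⟨e, rfl⟩ <;> rw [e]
    exacts [⟨by omega, hU0⟩, ⟨by omega, hU1⟩, ⟨by omega, hU2⟩]
  have injT : ∀ y ∈ T, ∀ y' ∈ T, iT y = iT y' → y = y' := by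
    intro y hy y' hy' e
    rcases selT y hy with ⟨e1, f1⟩ | ⟨e1, f1⟩ | ⟨e1, f1⟩ <;>
      rcases selT y' hy' with ⟨e2, f2⟩ | ⟨e2, f2⟩ | ⟨e2, f2⟩ <;> first | (rw [f1, f2]; done) | omega
  have injU : ∀ w ∈ U, ∀ w' ∈ U, iU w = iU w' → w = w' := by
    intro w hw w' hw' e
    rcases selU w hw with ⟨e1, f1⟩ | ⟨e1, f1⟩ | ⟨e1, f1⟩ <;>
      rcases selU w' hw' with ⟨e2, f2⟩ | ⟨e2, f2⟩ | ⟨e2, f2⟩ <;> first | (rw [f1, f2]; done) | omega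
  -- the vertex map: position `3 i_T + i_U`, lift `(λ₁, λ₂) = ε_y ε_w (κ₁ x, κ₂ x)`
  let lam1 : G × G × G → ZMod 3 := fun P => ε P.2.1 * ε P.2.2 * κ₁ P.1
  let lam2 : G × G × G → ZMod 3 := fun P => ε P.2.1 * ε P.2.2 * κ₂ P.1
  let φ : G × G × G → ℕ := fun P => 9 * (3 * iT P.2.1 + iU P.2.2) + ((lam1 P).val + 3 * (lam2 P).val)
  have memV : ∀ P ∈ J, True ∧ P.2.1 ∈ T ∧ P.2.2 ∈ U := fun P hP => ⟨trivial, hJT P hP, hJU P hP⟩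
  have φdiv : ∀ P ∈ J, φ P < 81 ∧ φ P / 9 / 3 = iT P.2.1 ∧ φ P / 9 % 3 = iU P.2.2 ∧ φ P % 9 % 3 = (lam1 P).val ∧
      φ P % 9 / 3 % 3 = (lam2 P).val := by
    intro P hP
    obtain ⟨-, hy, hw⟩ := memV P hP
    have h1 := (labT_iT _ hy).1; have h2 := (labU_iU _ hw).1; have h3 := (lam1 P).val_lt; have h4 := (lam2 P).val_lt
    simp only [φ]; omega
  -- a shift of a lift index read in `ZMod 3`, per component
  have shift_cast : ∀ (a b s0 s1 : ℕ), b = shiftIdx a s0 s1 →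
      ((b % 3 : ℕ) : ZMod 3) = ((a % 3 : ℕ) : ZMod 3) + ((s0 : ℕ) : ZMod 3) ∧
        ((b / 3 % 3 : ℕ) : ZMod 3) = ((a / 3 % 3 : ℕ) : ZMod 3) + ((s1 : ℕ) : ZMod 3) := by
    intro a b s0 s1 e
    subst e
    constructor
    · rw [show shiftIdx a s0 s1 % 3 = (a % 3 + s0) % 3 by unfold shiftIdx; omega, ZMod.natCast_mod, Nat.cast_add]
    · rw [show shiftIdx a s0 s1 / 3 % 3 = (a / 3 % 3 + s1) % 3 by unfold shiftIdx; omega, ZMod.natCast_mod, Nat.cast_add]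
  have h3 : (3 : ZMod 3) = 0 := by decide
  -- independence: a flagged pair of distinct cells contradicts the TPP
  have indep : ∀ P ∈ J, ∀ P' ∈ J, P ≠ P' → (adjRow (packAdj n) (φ P)).testBit (φ P') = false := by
    rintro ⟨x, y, w⟩ hP ⟨x', y', w'⟩ hP' hne
    rw [Bool.eq_false_iff]
    intro hbit
    obtain ⟨-, hyT, hwU⟩ := memV _ hP
    obtain ⟨-, hyT', hwU'⟩ := memV _ hP'
    obtain ⟨-, -, hpos, hcase⟩ := (adj_iff n _ _).1 hbit
    obtain ⟨-, d1, d2, d3, d4⟩ := φdiv _ hP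
    obtain ⟨-, d1', d2', d3', d4'⟩ := φdiv _ hP'
    simp only at d1 d2 d3 d4 d1' d2' d3' d4'
    have hpT : φ (x, y, w) / 9 / 3 = iT y := d1
    have hu := hJg _ hP; have hu' := hJg _ hP'
    simp only [key2] at hu hu'
    -- the `d = 1` component labels at the two positions
    obtain ⟨cy0, cy1⟩ := lab1_lab2 κ₁ κ₂ ε y; obtain ⟨cy0', cy1'⟩ := lab1_lab2 κ₁ κ₂ ε y'
    obtain ⟨cw0, cw1⟩ := lab1_lab2 κ₁ κ₂ ε w; obtain ⟨cw0', cw1'⟩ := lab1_lab2 κ₁ κ₂ ε w'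
    have posT : φ (x, y, w) / 9 = 3 * iT y + iU w := by simp only [φ]; omega
    have posT' : φ (x', y', w') / 9 = 3 * iT y' + iU w' := by simp only [φ]; omega
    have eT : (3 * iT y + iU w) / 3 = iT y := by have := (labU_iU w hwU).1; omega
    have eU : (3 * iT y + iU w) % 3 = iU w := by have := (labU_iU w hwU).1; omega
    have eT' : (3 * iT y' + iU w') / 3 = iT y' := by have := (labU_iU w' hwU').1; omega
    have eU' : (3 * iT y' + iU w') % 3 = iU w' := by have := (labU_iU w' hwU').1; omega
    rw [posT, posT'] at hcase
    simp only [dpp, eT, eU, eT', eU', (labT_iT y hyT).2, (labT_iT y' hyT').2, (labU_iU w hwU).2, (labU_iU w' hwU').2,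
      cy0, cy1, cy0', cy1', cw0, cw1, cw0', cw1'] at hcase
    rcases hcase with e | e
    · -- `λ' = λ − d(p,p')` componentwise: `E(P, P')` has both exponents `0`
      obtain ⟨e0, e1⟩ := shift_cast _ _ _ _ e
      rw [d3, d3', ZMod.natCast_zmod_val, ZMod.natCast_zmod_val, Nat.cast_mul] at e0
      rw [d4, d4', ZMod.natCast_zmod_val, ZMod.natCast_zmod_val, Nat.cast_mul] at e1
      rw [dn_cast _ (lab_lt κ₁ ε y) _ (lab_lt κ₁ ε y') _ (lab_lt κ₁ ε w) _ (lab_lt κ₁ ε w'), kOf_lab, kOf_lab, kOf_lab, kOf_lab,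
        h.eOf_lab, h.eOf_lab, h.eOf_lab, h.eOf_lab] at e0
      rw [dn_cast _ (lab_lt κ₂ ε y) _ (lab_lt κ₂ ε y') _ (lab_lt κ₂ ε w) _ (lab_lt κ₂ ε w'), kOf_lab, kOf_lab, kOf_lab, kOf_lab,
        h.eOf_lab, h.eOf_lab, h.eOf_lab, h.eOf_lab] at e1
      simp only [lam1, lam2, Nat.cast_ofNat] at e0 e1
      have hk1 : κ₁ (E2 (x, y, w) (x', y', w')) = 0 := by
        rw [h.kap1_E_fibre hu hu', e0]
        linear_combination (ε y * ε w * (ε y' * ε w') * (κ₁ y - ε y * ε y' * κ₁ y' + ε y * ε y' * (κ₁ w - ε w * ε w' * κ₁ w'))) * h3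
      have hk2 : κ₂ (E2 (x, y, w) (x', y', w')) = 0 := by
        rw [h.kap2_E_fibre hu hu', e1]
        linear_combination (ε y * ε w * (ε y' * ε w') * (κ₂ y - ε y * ε y' * κ₂ y' + ε y * ε y' * (κ₂ w - ε w * ε w' * κ₂ w'))) * h3
      have hE := h.inK_eq_one (h.inK_E hu hu') hk1 hk2
      exact hind _ hP _ hP' hne hE
    · -- `λ' = λ + d(p',p)`: `E(P', P)` is trivial
      obtain ⟨e0, e1⟩ := shift_cast _ _ _ _ e
      rw [d3, d3', ZMod.natCast_zmod_val, ZMod.natCast_zmod_val] at e0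
      rw [d4, d4', ZMod.natCast_zmod_val, ZMod.natCast_zmod_val] at e1
      rw [dn_cast _ (lab_lt κ₁ ε y') _ (lab_lt κ₁ ε y) _ (lab_lt κ₁ ε w') _ (lab_lt κ₁ ε w), kOf_lab, kOf_lab, kOf_lab, kOf_lab,
        h.eOf_lab, h.eOf_lab, h.eOf_lab, h.eOf_lab] at e0
      rw [dn_cast _ (lab_lt κ₂ ε y') _ (lab_lt κ₂ ε y) _ (lab_lt κ₂ ε w') _ (lab_lt κ₂ ε w), kOf_lab, kOf_lab, kOf_lab, kOf_lab,
        h.eOf_lab, h.eOf_lab, h.eOf_lab, h.eOf_lab] at e1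
      simp only [lam1, lam2] at e0 e1
      have hk1 : κ₁ (E2 (x', y', w') (x, y, w)) = 0 := by rw [h.kap1_E_fibre hu' hu, e0]; ring
      have hk2 : κ₂ (E2 (x', y', w') (x, y, w)) = 0 := by rw [h.kap2_E_fibre hu' hu, e1]; ring
      have hE := h.inK_eq_one (h.inK_E hu' hu) hk1 hk2
      exact hind _ hP' _ hP (Ne.symm hne) hE
  -- injectivity: position and normalised lift determine the cell inside a fibre
  have inj : Set.InjOn φ J := by
    rintro ⟨x, y, w⟩ hP ⟨x', y', w'⟩ hP' e
    obtain ⟨-, hyT, hwU⟩ := memV _ hP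
    obtain ⟨-, hyT', hwU'⟩ := memV _ hP'
    obtain ⟨-, d1, d2, d3, d4⟩ := φdiv _ hP
    obtain ⟨-, d1', d2', d3', d4'⟩ := φdiv _ hP'
    simp only at d1 d2 d3 d4 d1' d2' d3' d4' e
    have ey : y = y' := injT y hyT y' hyT' (by rw [← d1, ← d1', e])
    have ew : w = w' := injU w hwU w' hwU' (by rw [← d2, ← d2', e])
    subst ey ew
    have el1 : lam1 (x, y, w) = lam1 (x', y, w) := ZMod.val_injective 3 (by rw [← d3, ← d3', e])
    have el2 : lam2 (x, y, w) = lam2 (x', y, w) := ZMod.val_injective 3 (by rw [← d4, ← d4', e])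
    simp only [lam1, lam2] at el1 el2
    have hκ1 : κ₁ x = κ₁ x' := by
      linear_combination (ε y * ε w) * el1 + (-(ε w * ε w * (κ₁ x - κ₁ x'))) * h.eps_sq y + (-(κ₁ x - κ₁ x')) * h.eps_sq w
    have hκ2 : κ₂ x = κ₂ x' := by
      linear_combination (ε y * ε w) * el2 + (-(ε w * ε w * (κ₂ x - κ₂ x'))) * h.eps_sq y + (-(κ₂ x - κ₂ x')) * h.eps_sq w
    have hu := hJg _ hP; have hu' := hJg _ hP'
    simp only [key2] at hu hu'
    have hεx : ε x = ε x' := by rw [h.eps_of_fibre hu, h.eps_of_fibre hu']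
    have e1 : κ₁ (g⁻¹ * (x * y * w)) = κ₁ g⁻¹ + ε g⁻¹ * (κ₁ x + ε x * κ₁ y + ε x * ε y * κ₁ w) := by
      simp only [h.kap1_mul, h.eps_mul]
    have e2 : κ₁ (g⁻¹ * (x' * y * w)) = κ₁ g⁻¹ + ε g⁻¹ * (κ₁ x' + ε x' * κ₁ y + ε x' * ε y * κ₁ w) := by
      simp only [h.kap1_mul, h.eps_mul]
    have f1 : κ₂ (g⁻¹ * (x * y * w)) = κ₂ g⁻¹ + ε g⁻¹ * (κ₂ x + ε x * κ₂ y + ε x * ε y * κ₂ w) := by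
      simp only [h.kap2_mul, h.eps_mul]
    have f2 : κ₂ (g⁻¹ * (x' * y * w)) = κ₂ g⁻¹ + ε g⁻¹ * (κ₂ x' + ε x' * κ₂ y + ε x' * ε y * κ₂ w) := by
      simp only [h.kap2_mul, h.eps_mul]
    rw [hκ1, hεx, ← e2] at e1
    rw [hκ2, hεx, ← f2] at f1
    have := mul_left_cancel (h.inK_eq_of_kap hu hu' e1 f1)
    rw [mul_right_cancel (mul_right_cancel this)]
  -- count through the kernel theorem
  have hI := indep_card_le_sixteen hn' hsort (J.image φ)
    (by
      intro a ha b hb hab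
      obtain ⟨P, hP, rfl⟩ := mem_image.1 ha
      obtain ⟨P', hP', rfl⟩ := mem_image.1 hb
      exact indep P hP P' hP' fun e => hab (by rw [e]))
    (by
      intro a ha
      obtain ⟨P, hP, rfl⟩ := mem_image.1 ha
      exact (φdiv P hP).1)
  rwa [card_image_of_injOn inj] at hI

/-! ### Counting: each cell lies in exactly nine fibres -/

/-- The nine elements of `K`, as the image of `Fin 3 × Fin 3`. [folklore] -/
theorem card_K [DecidableEq G] : #((univ : Finset (Fin 3 × Fin 3)).image fun ab => c₁ ^ (ab.1 : ℕ) * c₂ ^ (ab.2 : ℕ)) = 9 := by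
  rw [card_image_of_injective _ ?_, card_univ, Fintype.card_prod, Fintype.card_fin]
  rintro ⟨a, b⟩ ⟨a', b'⟩ e
  simp only at e
  obtain ⟨k1, k2, -⟩ := h.kap_pow_pow a b
  obtain ⟨k1', k2', -⟩ := h.kap_pow_pow a' b'
  rw [e] at k1 k2
  have ha : (a : ℕ) = a' := by
    have := k1.symm.trans k1'
    have h1 := (ZMod.natCast_eq_natCast_iff' a a' 3).1 this
    rw [Nat.mod_eq_of_lt (by omega), Nat.mod_eq_of_lt (by omega)] at h1; exact h1
  have hb : (b : ℕ) = b' := by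
    have := k2.symm.trans k2'
    have h1 := (ZMod.natCast_eq_natCast_iff' b b' 3).1 this
    rw [Nat.mod_eq_of_lt (by omega), Nat.mod_eq_of_lt (by omega)] at h1; exact h1
  exact Prod.ext (Fin.ext ha) (Fin.ext hb)

open scoped Classical in
/-- Each cell `P` lies in exactly nine fibres: `#{g : g⁻¹ · key P ∈ K} = 9`. [folklore] -/
theorem card_fibres_through [Fintype G] [DecidableEq G] (P : G × G × G) :
    #((univ : Finset G).filter fun g => InK2 c₁ c₂ (g⁻¹ * key2 P)) = 9 := by
  classical
  have : ((univ : Finset G).filter fun g => InK2 c₁ c₂ (g⁻¹ * key2 P)) =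
      ((univ : Finset (Fin 3 × Fin 3)).image fun ab => c₁ ^ (ab.1 : ℕ) * c₂ ^ (ab.2 : ℕ)).image fun k => key2 P * k⁻¹ := by
    ext g'
    simp only [mem_filter, mem_univ, true_and, mem_image, Prod.exists]
    constructor
    · intro hg
      obtain ⟨a, ha, b, hb, e⟩ := (h.inK2_iff _).1 hg
      exact ⟨c₁ ^ a * c₂ ^ b, ⟨⟨a, ha⟩, ⟨b, hb⟩, rfl⟩, by rw [← e]; group⟩
    · rintro ⟨k, ⟨a, b, rfl⟩, rfl⟩
      rw [h.inK2_iff]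
      exact ⟨a, a.isLt, b, b.isLt, by group⟩
  rw [this, card_image_of_injective _ (fun a b e => by simpa using e), h.card_K]

/-- **Box form, basic case.**  With `1 ∈ T`, `1 ∈ U`, `#T, #U ≤ 3`, every independent cell set `V ⊆ G × T × U` (distinct
cells have word `E2 P P' ≠ 1`) has `9·|V| ≤ 16·|G|`: each cell is counted at the nine points of `key P · K`
(`card_fibres_through`), at most sixteen cells per fibre (`fibre_le_sixteen_indep`). [folklore] -/
theorem nine_mul_card_indep_le_basic [Fintype G] [DecidableEq G] {T U : Finset G} (hT : #T ≤ 3) (hU : #U ≤ 3)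
    (h1T : (1 : G) ∈ T) (h1U : (1 : G) ∈ U) {V : Finset (G × G × G)} (hVb : V ⊆ univ ×ˢ (T ×ˢ U))
    (hind : ∀ P ∈ V, ∀ P' ∈ V, P ≠ P' → E2 P P' ≠ 1) : 9 * #V ≤ 16 * Fintype.card G := by
  classical
  obtain ⟨t₁, t₂, hT', h12⟩ : ∃ a b : G, (∀ y ∈ T, y = 1 ∨ y = a ∨ y = b) ∧ lab2 κ₁ κ₂ ε a ≤ lab2 κ₁ κ₂ ε b := by
    obtain ⟨a, b, hab⟩ := exists_cover_three hT h1T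
    rcases le_total (lab2 κ₁ κ₂ ε a) (lab2 κ₁ κ₂ ε b) with hle | hle
    · exact ⟨a, b, hab, hle⟩
    · exact ⟨b, a, fun y hy => (hab y hy).imp_right Or.symm, hle⟩
  obtain ⟨u₁, u₂, hU', h34⟩ : ∃ a b : G, (∀ y ∈ U, y = 1 ∨ y = a ∨ y = b) ∧ lab2 κ₁ κ₂ ε a ≤ lab2 κ₁ κ₂ ε b := by
    obtain ⟨a, b, hab⟩ := exists_cover_three hU h1U
    rcases le_total (lab2 κ₁ κ₂ ε a) (lab2 κ₁ κ₂ ε b) with hle | hle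
    · exact ⟨a, b, hab, hle⟩
    · exact ⟨b, a, fun y hy => (hab y hy).imp_right Or.symm, hle⟩
  let r : (G × G × G) → G → Prop := fun P g => InK2 c₁ c₂ (g⁻¹ * key2 P)
  have hL : ∀ P ∈ V, #((univ : Finset G).bipartiteAbove r P) = 9 := fun P _ => h.card_fibres_through P
  have memV : ∀ P ∈ V, P.2.1 ∈ T ∧ P.2.2 ∈ U := fun P hP => by
    have := hVb hP; rw [mem_product, mem_product] at this; exact ⟨this.2.1, this.2.2⟩
  have hR : ∀ g ∈ (univ : Finset G), #(V.bipartiteBelow r g) ≤ 16 := fun g _ =>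
    h.fibre_le_sixteen_indep hT' hU' h12 h34 g (fun P hP => (memV P (mem_filter.1 hP).1).1)
      (fun P hP => (memV P (mem_filter.1 hP).1).2)
      (fun P hP P' hP' hne => hind P (mem_filter.1 hP).1 P' (mem_filter.1 hP').1 hne) fun P hP => (mem_filter.1 hP).2
  calc 9 * #V = ∑ P ∈ V, #((univ : Finset G).bipartiteAbove r P) := by rw [sum_const_nat hL, mul_comm]
    _ = ∑ g ∈ (univ : Finset G), #(V.bipartiteBelow r g) := sum_card_bipartiteAbove_eq_sum_card_bipartiteBelow _
    _ ≤ ∑ g ∈ (univ : Finset G), 16 := sum_le_sum hR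
    _ = 16 * Fintype.card G := by rw [sum_const, card_univ, smul_eq_mul, mul_comm]

/-- **Box form, general box: `α(G;|G|,3,3) ≤ (16/9)|G|`.** Every independent cell set `I ⊆ G × Y × W` with `#Y, #W ≤ 3`
(distinct cells have word `E2 P P' ≠ 1`) has `9·|I| ≤ 16·|G|`; reduction to the basic case by right translation of `Y` and `W`
(the word `E2` is unchanged).  This is the value `r = 16/9` of the census conjecture C9 (c) for the class `𝒞₂`, upper side. [folklore] -/
theorem nine_mul_card_indep_le [Fintype G] [DecidableEq G] {Y W : Finset G} (hY : #Y ≤ 3) (hW : #W ≤ 3)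
    {I : Finset (G × G × G)} (hI : I ⊆ univ ×ˢ (Y ×ˢ W)) (hind : ∀ P ∈ I, ∀ P' ∈ I, P ≠ P' → E2 P P' ≠ 1) :
    9 * #I ≤ 16 * Fintype.card G := by
  classical
  rcases Y.eq_empty_or_nonempty with rfl | ⟨y₀, hy₀⟩
  · have : I = ∅ := subset_empty.1 (by simpa using hI)
    simp [this]
  rcases W.eq_empty_or_nonempty with rfl | ⟨w₀, hw₀⟩
  · have : I = ∅ := subset_empty.1 (by simpa using hI)
    simp [this]
  let τ : G × G × G → G × G × G := fun P => (P.1, (P.2.1 * y₀⁻¹, P.2.2 * w₀⁻¹))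
  have τinj : Function.Injective τ := by
    rintro ⟨x, y, w⟩ ⟨x', y', w'⟩ e
    simp only [τ, Prod.mk.injEq] at e
    obtain ⟨ex, ey, ew⟩ := e
    rw [ex, mul_right_cancel ey, mul_right_cancel ew]
  set V : Finset (G × G × G) := I.image τ with hVdef
  have hVb : V ⊆ univ ×ˢ (Y.image (· * y₀⁻¹) ×ˢ W.image (· * w₀⁻¹)) := by
    intro Q hQ
    obtain ⟨P, hP, rfl⟩ := mem_image.1 hQ
    have hPb := hI hP
    simp only [mem_product, mem_univ, true_and] at hPb
    simp only [τ, mem_product, mem_univ, true_and, mem_image]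
    exact ⟨⟨P.2.1, hPb.1, rfl⟩, ⟨P.2.2, hPb.2, rfl⟩⟩
  have hindV : ∀ Q ∈ V, ∀ Q' ∈ V, Q ≠ Q' → E2 Q Q' ≠ 1 := by
    intro Q hQ Q' hQ' hne
    obtain ⟨P, hP, rfl⟩ := mem_image.1 hQ
    obtain ⟨P', hP', rfl⟩ := mem_image.1 hQ'
    rw [show E2 (τ P) (τ P') = E2 P P' by simp only [τ, E2]; group]
    exact hind P hP P' hP' fun e => hne (by rw [e])
  have h1Y : (1 : G) ∈ Y.image (· * y₀⁻¹) := mem_image.2 ⟨y₀, hy₀, mul_inv_cancel y₀⟩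
  have h1W : (1 : G) ∈ W.image (· * w₀⁻¹) := mem_image.2 ⟨w₀, hw₀, mul_inv_cancel w₀⟩
  have h9 := h.nine_mul_card_indep_le_basic (card_image_le.trans hY) (card_image_le.trans hW) h1Y h1W hVb hindV
  rwa [hVdef, card_image_of_injective I τinj] at h9

/-- Basic case (`1 ∈ T`, `1 ∈ U`) of THE LAW: `9·|S||T||U| ≤ 16·|G|` for a TPP triple with `#T, #U ≤ 3` (the cell set
`S × T × U` is independent). [folklore] -/
theorem nine_mul_volume_le_basic [Fintype G] [DecidableEq G] {S T U : Finset G} (htpp : TripleProductProperty S T U)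
    (hT : #T ≤ 3) (hU : #U ≤ 3) (h1T : (1 : G) ∈ T) (h1U : (1 : G) ∈ U) : 9 * (#S * #T * #U) ≤ 16 * Fintype.card G := by
  have hcardV : #(S ×ˢ (T ×ˢ U)) = #S * #T * #U := by rw [card_product, card_product, mul_assoc]
  rw [← hcardV]
  refine h.nine_mul_card_indep_le_basic hT hU h1T h1U (product_subset_product (subset_univ S) Subset.rfl) ?_
  rintro ⟨x, y, w⟩ hP ⟨x', y', w'⟩ hP' hne hE
  rw [mem_product, mem_product] at hP hP'
  obtain ⟨ex, ey, ew⟩ := htpp x hP.1 x' hP'.1 y hP.2.1 y' hP'.2.1 w hP.2.2 w' hP'.2.2 hE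
  exact hne (by rw [ex, ey, ew])

/-- **THE LAW of the class `𝒞₂`: `9·|S||T||U| ≤ 16·|G|`** for every TPP triple with `|T|, |U| ≤ 3` in a finite group with
coordinates `Coord2 c₁ c₂ κ₁ κ₂ ε`. [folklore] -/
theorem nine_mul_volume_le [Fintype G] [DecidableEq G] {S T U : Finset G} (htpp : TripleProductProperty S T U) (hT : #T ≤ 3)
    (hU : #U ≤ 3) : 9 * (#S * #T * #U) ≤ 16 * Fintype.card G := by
  rcases S.eq_empty_or_nonempty with rfl | hS
  · simp
  rcases T.eq_empty_or_nonempty with rfl | hTn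
  · simp
  rcases U.eq_empty_or_nonempty with rfl | hUn
  · simp
  obtain ⟨S', T', U', htpp', -, h1T, h1U, hcS, hcT, hcU⟩ := exists_basic_tpp htpp hS hTn hUn
  rw [← hcS, ← hcT, ← hcU]
  exact h.nine_mul_volume_le_basic htpp' (by rw [hcT]; exact hT) (by rw [hcU]; exact hU) h1T h1U

/-- **No `⟨N, m, p⟩` with `m, p ≤ 3` when `16|G| < 9Nmp`.** [folklore] -/
theorem not_realizesTPP [Fintype G] [DecidableEq G] {N m p : ℕ} (hm : m ≤ 3) (hp : p ≤ 3)
    (hlt : 16 * Fintype.card G < 9 * (N * m * p)) :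
    ¬ Literature.Computability.AlgebraicComplexity.RealizesTPP G N m p := by
  rintro ⟨S, T, U, hS, hT, hU, htpp⟩
  have := h.nine_mul_volume_le htpp (by omega) (by omega)
  rw [hS, hT, hU] at this
  omega

/-- **No `⟨N, 3, 3⟩` when `16|G| < 81N`**, in every ordering of the sizes. [folklore] -/
theorem not_realizesTPP_three_three [Fintype G] [DecidableEq G] (N : ℕ) (hlt : 16 * Fintype.card G < 81 * N) :
    ¬ Literature.Computability.AlgebraicComplexity.RealizesTPP G N 3 3 ∧
      ¬ Literature.Computability.AlgebraicComplexity.RealizesTPP G 3 N 3 ∧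
        ¬ Literature.Computability.AlgebraicComplexity.RealizesTPP G 3 3 N := by
  have h1 : ¬ Literature.Computability.AlgebraicComplexity.RealizesTPP G N 3 3 :=
    h.not_realizesTPP le_rfl le_rfl (by omega)
  exact ⟨h1, fun h' => h1 h'.rotate, fun h' => h1 h'.rotate.rotate⟩

end Coord2

end Summit.MatrixMultiplication.OmegaCensus.DihC3Sq
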